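import Summits.KontsevichZagierPeriods.Zeta5Search.Barrier.ConeGammaShiftData

/-!
# ζ(5) search — BARRIER: the small-shift identity (P2's Lemma B) — `P(εδ) − P(0)` is EXACTLY linear in `ε`

HONEST FRAMING (cell `pub-zeta5`): systematic search; no irrationality claim unless kernel-certified. MODEL objects
under Brown–Zudilin's (28)+(30) accounting ([BZ22] = arXiv:2210.03391); nothing here is a statement about `ζ(5)`;
records in print UNMOVED. Part 2/2 of item (P4) of `BARRIER-PLAN.md` §2b (theory seat cert-2 g17, WAKE w3 of
lead/lit g23; source: P2 g11 `SE-STRUCTURE.md` §2 Lemma B «first-order exactness of the period integral», the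
lead's S-E″ identity `G(δ) − G(0) = S(t₀; v(δ))`). The conjectured lemma S-E is NOT stated or filed.

With `P(δ) = translateIntegral a T δ = ∫₀^T 𝒩(u·s(a) + δ) du` (`ConeGammaShift`), the data `Y, W, K, d` and
Claims 1–2 of `ConeGammaShiftData`, and the sorted breakpoints `bkpt a T m` of `ConeGammaBreakpoints`:

* `integral_cell_scaling` (calculus: split a cell `[b_m, b_{m+1}]` at `b_m + ηW`, `b_{m+1} − ηW`, the middle
  vanishes, substitute `u = b + ηw` near the ends), `shiftDiff`, `integral_shiftDiff_cell`;
* **`translateIntegral_shift_linear`** (Lemma B): for a direction with all 28 forms positive, a period `T`, and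
  scales `0 < ε ≤ ε'` with `ε'·K < 1`, `ε'·K < d` and `2ε'·W ≤` every breakpoint gap of `[0,T]`,
  `P(εδ) − P(0) = (ε/ε')·(P(ε'δ) − P(0))` — the translate integral is EXACTLY affine in the size of the shift
  below that explicit radius; **`translateIntegral_shift_eq_slope`**: hence `P(εδ) − P(0) = ε·σ` with one slope
  `σ` (the one-sided derivative at `0` in direction `δ`: P2's `Σ_b K_b(δ) = λ₀·S(t₀; v(δ))`) for all small `ε`.
Not here (honest): the identification of `σ` with the germ integrals `K_b` / the cusp coefficient `S`, the
log-cusp expansion of `Φ` itself (P2's Theorem §3), and any CONSTANT — those are S-E's analytic content.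
-/

noncomputable section

open Set MeasureTheory
open scoped Topology

namespace Summit.KontsevichZagierPeriods.Zeta5Search.Barrier.ConeGamma

/-! ### Calculus: one cell -/

/-- **One cell of the breakpoint partition.** For integrable `D`, `D'` (the differences at scales `ε ≤ ε'`) that
vanish at distance `≥ ηW` from the endpoints of `[L, R]` (`η = ε, ε'`) and agree after rescaling near the endpoints,
`∫_L^R D = (ε/ε')·∫_L^R D'`, provided `2ε'W ≤ R − L`. -/
theorem integral_cell_scaling {D D' : ℝ → ℝ} {L R W ε ε' : ℝ} (hW : 0 < W) (hε : 0 < ε) (hεε' : ε ≤ ε')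
    (hgap : 2 * ε' * W ≤ R - L)
    (hD : ∀ α β, IntervalIntegrable D volume α β) (hD' : ∀ α β, IntervalIntegrable D' volume α β)
    (hfar : ∀ u ∈ Icc (L + ε * W) (R - ε * W), D u = 0)
    (hfar' : ∀ u ∈ Icc (L + ε' * W) (R - ε' * W), D' u = 0)
    (hconeL : ∀ w ∈ Icc 0 W, D (L + ε * w) = D' (L + ε' * w))
    (hconeR : ∀ w ∈ Icc (-W) 0, D (R + ε * w) = D' (R + ε' * w)) :
    ∫ u in L..R, D u = (ε / ε') * ∫ u in L..R, D' u := by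
  have hε' : 0 < ε' := hε.trans_le hεε'
  have hεW : ε * W ≤ ε' * W := mul_le_mul_of_nonneg_right hεε' hW.le
  -- three pieces
  have split : ∀ (F : ℝ → ℝ) (η : ℝ), (∀ α β, IntervalIntegrable F volume α β) →
      ∫ u in L..R, F u = (∫ u in L..(L + η * W), F u) + ((∫ u in (L + η * W)..(R - η * W), F u) +
        ∫ u in (R - η * W)..R, F u) := by
    intro F η hF
    rw [intervalIntegral.integral_add_adjacent_intervals (hF _ _) (hF _ _),
      intervalIntegral.integral_add_adjacent_intervals (hF _ _) (hF _ _)]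
  -- middle pieces vanish
  have mid : ∫ u in (L + ε * W)..(R - ε * W), D u = 0 := by
    rw [intervalIntegral.integral_congr (g := fun _ => (0 : ℝ)) (fun u hu => ?_)]
    · simp
    · rw [uIcc_of_le (by nlinarith)] at hu
      exact hfar u hu
  have mid' : ∫ u in (L + ε' * W)..(R - ε' * W), D' u = 0 := by
    rw [intervalIntegral.integral_congr (g := fun _ => (0 : ℝ)) (fun u hu => ?_)]
    · simp
    · rw [uIcc_of_le (by nlinarith)] at hu
      exact hfar' u hu
  -- left pieces by substitution `u = L + η w`, `w ∈ [0, W]`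
  have left : ∀ (F : ℝ → ℝ) (η : ℝ), ∫ u in L..(L + η * W), F u = η * ∫ w in (0 : ℝ)..W, F (L + η * w) := by
    intro F η
    have h := intervalIntegral.smul_integral_comp_add_mul (f := F) (a := 0) (b := W) η L
    rw [mul_zero, add_zero, smul_eq_mul] at h
    exact h.symm
  -- right pieces by substitution `u = R + η w`, `w ∈ [−W, 0]`
  have right : ∀ (F : ℝ → ℝ) (η : ℝ), ∫ u in (R - η * W)..R, F u = η * ∫ w in (-W : ℝ)..0, F (R + η * w) := by
    intro F η
    have h := intervalIntegral.smul_integral_comp_add_mul (f := F) (a := -W) (b := 0) η R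
    rw [mul_zero, add_zero, smul_eq_mul, mul_neg, ← sub_eq_add_neg] at h
    exact h.symm
  have coneL : ∫ w in (0 : ℝ)..W, D (L + ε * w) = ∫ w in (0 : ℝ)..W, D' (L + ε' * w) :=
    intervalIntegral.integral_congr fun w hw => hconeL w (by rwa [uIcc_of_le hW.le] at hw)
  have coneR : ∫ w in (-W : ℝ)..0, D (R + ε * w) = ∫ w in (-W : ℝ)..0, D' (R + ε' * w) :=
    intervalIntegral.integral_congr fun w hw => hconeR w (by rwa [uIcc_of_le (by linarith)] at hw)
  rw [split D ε hD, split D' ε' hD', mid, mid', left D ε, left D' ε', right D ε, right D' ε', coneL, coneR]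
  field_simp
  ring

/-! ### Lemma B -/

/-- The shift difference at scale `η`: `D_η(u) = 𝒩(u·s(a) + ηδ) − 𝒩(u·s(a))`. -/
def shiftDiff (a : Dir) (δ : Fin 8 → ℝ) (η u : ℝ) : ℝ :=
  (torusN (u • sParam a + η • δ) : ℝ) - torusN (u • sParam a)

/-- `D_η` is interval integrable. -/
theorem intervalIntegrable_shiftDiff (a : Dir) (δ : Fin 8 → ℝ) (η α β : ℝ) :
    IntervalIntegrable (shiftDiff a δ η) volume α β := by
  have h0 := intervalIntegrable_torusN_line a 0 α β
  simp only [add_zero] at h0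
  exact (intervalIntegrable_torusN_line a (η • δ) α β).sub h0

/-- `P(ηδ) − P(0) = ∫₀^T D_η`. -/
theorem translateIntegral_sub_eq (a : Dir) (T : ℝ) (δ : Fin 8 → ℝ) (η : ℝ) :
    translateIntegral a T (η • δ) - translateIntegral a T 0 = ∫ u in (0 : ℝ)..T, shiftDiff a δ η u := by
  unfold translateIntegral shiftDiff
  have h0 := intervalIntegrable_torusN_line a 0 0 T
  simp only [add_zero] at h0 ⊢
  rw [intervalIntegral.integral_sub (intervalIntegrable_torusN_line a (η • δ) 0 T) h0]

/-- **One cell of the period**: on `[b_m, b_{m+1}]` the shift differences at scales `ε ≤ ε'` have proportional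
integrals. -/
theorem integral_shiftDiff_cell {a : Dir} (hpos : ∀ k, 0 < h28 a k) {T : ℝ}
    (hper : ∀ k : Fin 28, ∃ z : ℤ, T * h28 a k = z) (δ : Fin 8 → ℝ) {ε ε' : ℝ} (hε : 0 < ε) (hεε' : ε ≤ ε')
    (h1 : ε' * clusterBound a δ < 1) (h2 : ε' * clusterBound a δ < wallDist a T) {m : ℕ}
    (hm : m + 1 < (bkpts a T).card) (hgap : 2 * ε' * clusterWidth a δ ≤ bkpt a T (m + 1) - bkpt a T m) :
    ∫ u in (bkpt a T m)..(bkpt a T (m + 1)), shiftDiff a δ ε u =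
      (ε / ε') * ∫ u in (bkpt a T m)..(bkpt a T (m + 1)), shiftDiff a δ ε' u := by
  have hε' : 0 < ε' := hε.trans_le hεε'
  have hW := clusterWidth_pos hpos δ
  have hLmem : bkpt a T m ∈ bkpts a T := bkpt_mem (by omega)
  have hRmem : bkpt a T (m + 1) ∈ bkpts a T := bkpt_mem hm
  have hL0 : 0 ≤ bkpt a T m := (mem_bkpts_bounds hLmem).1
  have hRT : bkpt a T (m + 1) ≤ T := (mem_bkpts_bounds hRmem).2
  -- `ηY < 1` for `η ≤ ε'` since `Y ≤ K`
  have hYK : shiftSize δ ≤ clusterBound a δ := by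
    unfold clusterBound
    have := mul_nonneg hW.le (xMax_pos hpos).le
    linarith
  have hηY : ∀ η, 0 ≤ η → η ≤ ε' → η * shiftSize δ < 1 := fun η _ hη =>
    lt_of_le_of_lt (mul_le_mul hη hYK (shiftSize_nonneg δ) hε'.le) h1
  -- far field on the cell, for any scale `η ≤ ε'`
  have far : ∀ η, 0 ≤ η → η ≤ ε' →
      ∀ u ∈ Icc (bkpt a T m + η * clusterWidth a δ) (bkpt a T (m + 1) - η * clusterWidth a δ),
        shiftDiff a δ η u = 0 := by
    intro η hη0 hηε' u hu
    unfold shiftDiff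
    rw [sub_eq_zero]
    have hηW : 0 ≤ η * clusterWidth a δ := mul_nonneg hη0 hW.le
    have hu0 : 0 ≤ u := by linarith [hu.1]
    have huT : u ≤ T := by linarith [hu.2]
    have h := torusN_shift_eq_of_far hpos hper δ hη0 (hηY η hη0 hηε') hu0 huT (fun b hb => ?_)
    · exact_mod_cast h
    rcases le_or_gt b (bkpt a T m) with hbL | hbL
    · rw [abs_of_nonneg (by linarith [hu.1])]
      linarith [hu.1]
    · have hbR : bkpt a T (m + 1) ≤ b := no_bkpt_between hm hb hbL
      rw [abs_of_nonpos (by linarith [hu.2])]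
      linarith [hu.2]
  refine integral_cell_scaling hW hε hεε' hgap (intervalIntegrable_shiftDiff a δ ε)
    (intervalIntegrable_shiftDiff a δ ε') (far ε hε.le hεε') (far ε' hε'.le le_rfl)
    (fun w hw => ?_) (fun w hw => ?_)
  · have habs : |w| ≤ clusterWidth a δ := by rw [abs_of_nonneg hw.1]; exact hw.2
    simp only [shiftDiff]
    exact shiftDiff_scaling hpos hLmem δ hε hεε' habs h1 h2
  · have habs : |w| ≤ clusterWidth a δ := by rw [abs_of_nonpos hw.2]; linarith [hw.1]
    simp only [shiftDiff]
    exact shiftDiff_scaling hpos hRmem δ hε hεε' habs h1 h2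

/-- **LEMMA B (the small-shift identity; P2 g11 SE-STRUCTURE §2).** For a direction with all 28 forms positive, a
period `T`, a shift `δ`, and scales `0 < ε ≤ ε'` with `ε'·K < 1`, `ε'·K < d` (wall distance) and `2ε'·W ≤` every
breakpoint gap of `[0,T]`:  `P(εδ) − P(0) = (ε/ε')·(P(ε'δ) − P(0))` — the translate integral is EXACTLY affine
in the size of the shift below this explicit radius. -/
theorem translateIntegral_shift_linear {a : Dir} (hpos : ∀ k, 0 < h28 a k) {T : ℝ} (hT : 0 < T)
    (hper : ∀ k : Fin 28, ∃ z : ℤ, T * h28 a k = z) (δ : Fin 8 → ℝ) {ε ε' : ℝ} (hε : 0 < ε) (hεε' : ε ≤ ε')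
    (h1 : ε' * clusterBound a δ < 1) (h2 : ε' * clusterBound a δ < wallDist a T)
    (hgap : ∀ m, m + 1 < (bkpts a T).card → 2 * ε' * clusterWidth a δ ≤ bkpt a T (m + 1) - bkpt a T m) :
    translateIntegral a T (ε • δ) - translateIntegral a T 0 =
      (ε / ε') * (translateIntegral a T (ε' • δ) - translateIntegral a T 0) := by
  rw [translateIntegral_sub_eq, translateIntegral_sub_eq]
  have hc := two_le_card_bkpts a hT
  have hsum : ∀ η, ∫ u in (0 : ℝ)..T, shiftDiff a δ η u =
      ∑ m ∈ Finset.range ((bkpts a T).card - 1), ∫ u in (bkpt a T m)..(bkpt a T (m + 1)), shiftDiff a δ η u := by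
    intro η
    have h := intervalIntegral.sum_integral_adjacent_intervals (a := bkpt a T) (n := (bkpts a T).card - 1)
      (fun m _ => intervalIntegrable_shiftDiff a δ η _ _)
    rw [bkpt_zero a hT, bkpt_last a hT] at h
    exact h.symm
  rw [hsum ε, hsum ε', Finset.mul_sum]
  refine Finset.sum_congr rfl fun m hm => ?_
  rw [Finset.mem_range] at hm
  exact integral_shiftDiff_cell hpos hper δ hε hεε' h1 h2 (by omega) (hgap m (by omega))

/-- **Lemma B, slope form**: for `0 < ε ≤ ε₀` with `ε₀` admissible as above, `P(εδ) − P(0) = ε·σ` with the SAME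
slope `σ = (P(ε₀δ) − P(0))/ε₀` — the one-sided derivative of the translate integral at `0` in direction `δ` (P2's
`Σ_b K_b(δ)`, the lead's `λ₀·S(t₀; v(δ))`) is attained exactly by every small difference quotient. -/
theorem translateIntegral_shift_eq_slope {a : Dir} (hpos : ∀ k, 0 < h28 a k) {T : ℝ} (hT : 0 < T)
    (hper : ∀ k : Fin 28, ∃ z : ℤ, T * h28 a k = z) (δ : Fin 8 → ℝ) {ε ε₀ : ℝ} (hε : 0 < ε) (hεε₀ : ε ≤ ε₀)
    (h1 : ε₀ * clusterBound a δ < 1) (h2 : ε₀ * clusterBound a δ < wallDist a T)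
    (hgap : ∀ m, m + 1 < (bkpts a T).card → 2 * ε₀ * clusterWidth a δ ≤ bkpt a T (m + 1) - bkpt a T m) :
    translateIntegral a T (ε • δ) - translateIntegral a T 0 =
      ε * ((translateIntegral a T (ε₀ • δ) - translateIntegral a T 0) / ε₀) := by
  rw [translateIntegral_shift_linear hpos hT hper δ hε hεε₀ h1 h2 hgap]
  ring

end Summit.KontsevichZagierPeriods.Zeta5Search.Barrier.ConeGamma

end
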